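import Summits.ResolutionOfSingularities.ResolutionOfSingularities.Theorems.HilbertSamuelEliminationSigmaMaxModificationsCorridor3Directrix214SharpNearFibreBase
import HarnessLib

/-!
# [OURS · L1 W4.2] 2.14♯ for an ARBITRARY permissible centre, NEAR-FIBRE (locus) form: the binder
# `Moving.Theorem314_nearFibre_geomDir` of the W-low rows DISCHARGED from printed facts, and the near point is
# `k(x)`-rational (`theorem314_nearFibre_geomDir_of_facts`)

Cell res-hironaka, rung L, slot W4.2 (crux chain w42 `SigmaMaxModifications`, stmt-ResolutionOfSingularities-18506;
conjunct `SigmaMaxModificationsCorridor3`, stmt-ResolutionOfSingularities-19249), stub worker res-L1-w42-stub-3 (gen 4),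
row `stub_Wlow3M_two` (β census `wlow3TwoM_census`, p520092) and its β-twin strata socket (stub-4,
`…Corridor3WLadderStrataNearFibreGeomDir`, p517608). [OURS · L1 W4.2] new-combination; NOT a statement of any source,
and NOT a statement of H. Hironaka's 2017 manuscript.

WHAT. Stub-4's binder `Moving.Theorem314_nearFibre_geomDir` — CJS Thm. 3.14 in NEAR-FIBRE form («for `X` excellent,
`D = V(I)` permissible, `π` the blow-up in `D`, `x ∈ D` with (F1♯) `char k(x) = 0 ∨ ē_x(X) + 2 ≤ 2·char k(x)` and
`e_x(X) ≤ dim 𝒪_{D,x} + 1`, the points of `π⁻¹(x)` near to `x` form a SUBSINGLETON»), consumed by the strata halves of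
BOTH W-low rows (its (F1) shadow is the printed fact F-61 `Thm314_nearFibre_subsingleton`, p514197) — is PROVED here
from two printed facts taken BY NAME:

* F-51′ `Hironaka1970_thmIV` ([H4] Th. IV, general permissible centre: the ideal `J_D` of `C_{X,D,x}` is generated
  inside Hironaka's algebra `U(𝔭_{x'})` of the near point `x' ∈ ℙ(N_{D,x})`), and
* F-split `HerrmannIkedaOrbanz1988_cor_21_11` (Hironaka–Grothendieck isomorphism `J_z = J_D · k[Z]` along a regular
  normally flat centre),

exactly the premises of res-type-001's T7b `theorem314_geomDir_of_thmIV` (NUMERICAL form `dim 𝒪_{D,x} < e_x(X)`, p518785)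
MINUS CJS Thm. 3.14 as printed: the characteristic-`0` branch now runs through res-D-lib-1's
`HironakaScheme.directrixSpace_le_prime_of_charZero` (p519965), the positive-characteristic branch through T7's
`directrixSpace_le_prime_of_facts` with F-52 `Hironaka1970_thm1_cor_holds` and F-50b
`mizutani1973_vectorGroup_of_dim_le_of_hironaka` (both PROVED in the tree).

HOW (CJS p. 51 «`x' ∈ ℙ(Dir_x(X)/T_x(D)) ⊂ π_X⁻¹(x) = Proj(A_D)`», p. 103 L32 «if `e ≤ 1` then `k(y) = k(x)`»): with
`g` MINIMAL generators of `I = I_{D,x}`, `y` a lift of a regular system of parameters of `𝒪_{D,x}`, F-split gives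
`e_x(X) = e(J_z) ≥ e(J_D) + dim 𝒪_{D,x}`, so `e_x(X) ≤ dim 𝒪_{D,x} + 1` forces `e(J_D) ≤ 1`; at a near point `x'`, F-51′ and
the Hironaka–Mizutani core put the directrix space `𝒯(J_D)` inside the homogeneous prime `𝔭_{x'}` of `x'`, which misses
a variable — so `e(J_D) = 1`, `𝒯(J_D)` is a HYPERPLANE, and (`…Corridor3NormalDirectrixLine`, the normal-cone twin of the
tree's `ProjDirectrixLine`) the exceptional ideal at `x'` is generated by ONE section `c_j` of `D` with all ratios `c_k/c_j`
taking `k(x)`-rational values `β_k` computed in `𝒪_{X,x}`; by the chart plumbing `…Corridor3NearFibreChart` (the tree's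
`ProjDirLine` generalised from a closed to an ARBITRARY point `x`: saturation at the prime `𝔭_x`) all near points over
`x` lie on the chart `D₊(c_j t)` at THE prime containing `𝔭_x·R[I/c_j] + (ŝ_k c_k/c_j − r̂_k)_k`; such a prime is unique,
and its residue field is `k(x)`.

RESULTS: `theorem314_nearFibre_geomDir_and_isIso_of_facts` (subsingleton AND `k(x) ≅ k(x')` at the near point),
`theorem314_nearFibre_geomDir_of_facts : Hironaka1970_thmIV → HerrmannIkedaOrbanz1988_cor_21_11 →
Moving.Theorem314_nearFibre_geomDir`, `thm314_nearFibre_subsingleton_of_facts` (the printed F-61 DISCHARGED modulo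
F-51′ + F-split, via stub-4's `thm314_nearFibre_subsingleton_of_geomDir`); by-products with CJS Thm. 3.14 REMOVED as a
premise: `theorem314_geomDir_of_thmIV_of_split` (the numerical binder from F-51′ + F-split alone) and
`thm314_point_locus_geomDir_of_thmIV_point` (the point-centre locus binder from F-51 alone, every characteristic).

AI-written (res-L1-w42-stub-3 g4); AI review is weaker than expert review.
-/

set_option linter.dupNamespace false

noncomputable section

open CategoryTheory AlgebraicGeometry TopologicalSpace IsLocalRing MvPolynomial
open Literature.AlgebraicGeometry.Resolution Literature.AlgebraicGeometry.Resolution.HironakaScheme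
open Literature.RingTheory.HilbertSamuel Literature.RingTheory.MvPolynomial
open Literature.AlgebraicGeometry.CossartJannsenSaito2020
open Summit.ResolutionOfSingularities.ResolutionOfSingularities.Theorems.SigmaMaxModificationsCorridor3.Moving

namespace Summit.ResolutionOfSingularities.ResolutionOfSingularities.Theorems.SigmaMaxModificationsCorridor3.Directrix214Sharp

universe u

/-! ## The theorem -/

set_option maxHeartbeats 800000 in
-- one long assembly over the large chart types (the Rees chart `chartRing c j` over `Γ(X, U)`), as for `projDir_line`
/-- **[OURS · L1 W4.2] 2.14♯ for an arbitrary permissible centre, NEAR-FIBRE form, with the rationality of the near point —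
from F-51′ ([H4] Th. IV) and F-split (Hironaka–Grothendieck) alone.** For `X` locally noetherian and excellent, `D = V(I)`
permissible, `π : X' → X` a blow-up in `D`, `N ≥ dim X`, `x ∈ D` with `char k(x) = 0 ∨ ē_x(X) + 2 ≤ 2·char k(x)` and
`e_x(X) ≤ dim(𝒪_{X,x}/I_x) + 1`: the set of points `x' ∈ π⁻¹(x)` with `H^N_{X'}(x') = H^N_X(x)` is a SUBSINGLETON, and at
such a point `k(x) → k(x')` is an isomorphism. [OURS · L1 W4.2] new-combination (CJS Thm. 3.14's conclusion
`x' ∈ ℙ(Dir_x(X)/T_x(D))` read when that space is `∅` or `ℙ⁰_{k(x)}`); NOT a statement of any source; AI-written, weaker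
than expert review. [cite: CossartJannsenSaito2020, Thm. 3.14 (p. 51), p. 103 L32; Hironaka1970NumericalCharacters, Th. IV] -/
theorem theorem314_nearFibre_geomDir_and_isIso_of_facts (h51 : Hironaka1970_thmIV.{u})
    (hsplit : HerrmannIkedaOrbanz1988_cor_21_11.{u})
    {X X' : Scheme.{u}} [IsLocallyNoetherian X] (π : X' ⟶ X) (D : X.IdealSheafData)
    (hexc : Scheme.IsExcellent X) (hperm : IdealSheafData.IsPermissible D) (hπ : IsBlowup π D)
    (N : ℕ) (hdim : topologicalKrullDim X ≤ (N : WithBot ℕ∞))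
    (x : X) (hxD : x ∈ D.support) (hgeo : GeomDirHypothesis X x)
    (he : (Scheme.dirDim X x : WithBot ℕ∞) ≤ ringKrullDim (X.presheaf.stalk x ⧸ stalkIdeal D x) + 1) :
    {x' : X' | π.base x' = x ∧ Scheme.hsFun X' N x' = Scheme.hsFun X N x}.Subsingleton ∧
      ∀ x' : X', π.base x' = x → Scheme.hsFun X' N x' = Scheme.hsFun X N x → IsIso (π.residueFieldMap x') := by
  classical
  suffices main : ∀ x₁ : X', π.base x₁ = x → Scheme.hsFun X' N x₁ = Scheme.hsFun X N x →
      (∀ x₂ : X', π.base x₂ = x → Scheme.hsFun X' N x₂ = Scheme.hsFun X N x → x₁ = x₂) ∧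
        IsIso (π.residueFieldMap x₁) by
    exact ⟨fun x₁ h₁ x₂ h₂ => (main x₁ h₁.1 h₁.2).1 x₂ h₂.1 h₂.2, fun x' h hn => (main x' h hn).2⟩
  intro x₁ hx₁ hn₁
  subst hx₁
  -- (0) an affine open `U ∋ x`, `𝔭 = 𝔭_x ⊆ R = Γ(X, U)`, `𝒪_{X,x} = R_𝔭`
  obtain ⟨U, hxU⟩ : ∃ U : X.affineOpens, π.base x₁ ∈ (U : X.Opens) := by
    obtain ⟨U₀, hU, hxU, -⟩ :=
      exists_isAffineOpen_mem_and_subset (X := X) (x := π.base x₁) (U := ⊤) (Opens.mem_top _)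
    exact ⟨⟨U₀, hU⟩, hxU⟩
  obtain ⟨𝔭, h𝔭⟩ : ∃ 𝔭 : PrimeSpectrum Γ(X, U), 𝔭 = U.2.primeIdealOf ⟨π.base x₁, hxU⟩ := ⟨_, rfl⟩
  haveI : IsNoetherianRing Γ(X, U) := IsLocallyNoetherian.component_noetherian U
  set A := X.presheaf.stalk (π.base x₁) with hA
  letI : Algebra Γ(X, U) A := TopCat.Presheaf.algebra_section_stalk X.presheaf (⟨π.base x₁, hxU⟩ : (U : X.Opens))
  haveI hloc : IsLocalization.AtPrime A 𝔭.asIdeal := h𝔭 ▸ U.2.isLocalization_stalk ⟨π.base x₁, hxU⟩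
  have halg : ∀ s : Γ(X, U), algebraMap Γ(X, U) A s = (X.presheaf.germ U (π.base x₁) hxU).hom s := fun _ => rfl
  -- `I = I_{D,x}`, generators `c` of `D(U)`
  set I : Ideal A := stalkIdeal D (π.base x₁) with hI
  have hIperm : I.IsPermissible := hperm _ hxD
  obtain ⟨r, c, hc⟩ : ∃ (r : ℕ) (c : Fin r → Γ(X, U)), Ideal.span (Set.range c) = D.ideal U :=
    Submodule.fg_iff_exists_fin_generating_family.mp (IsNoetherian.noetherian (D.ideal U))
  have hIc : D.ideal U = Ideal.span (Set.range c) := hc.symm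
  have hspanA : Ideal.span (Set.range fun l => algebraMap Γ(X, U) A (c l)) = I := by
    rw [hI, stalkIdeal_eq_map_germ D U hxU, hIc, Ideal.map_span, ← Set.range_comp]
    rfl
  have hcm : ∀ l, algebraMap Γ(X, U) A (c l) ∈ I := fun l => hspanA ▸ Ideal.subset_span ⟨l, rfl⟩
  -- minimal generators `g` of `I`, the numerics of F-split
  obtain ⟨n, s, g, y, hz, hgI, hn, hdimI, hE, hJz⟩ := exists_minimal_generators_data hsplit hIperm
  have hm : (Ideal.span (Set.range g)).spanFinrank = n + 1 := by rw [hgI, hn]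
  have hdle : directrixDim (normalConeIdeal g) ≤ 1 := directrixDim_normalCone_le_one hdimI hE hJz he
  have hone : 1 ≤ directrixDim (normalConeIdeal g) :=
    one_le_directrixDim_normalCone_of_near h51 hexc hperm hπ hdim hxD hgeo hgI hn hE hJz hn₁
  have hd : directrixDim (normalConeIdeal g) = 1 := le_antisymm hdle hone
  -- expansions `c_l = Σ_i a_{li} g_i`
  have hexp : ∀ l, ∃ a : Fin (n + 1) → A, ∑ i, a i * g i = algebraMap Γ(X, U) A (c l) :=
    fun l => Ideal.mem_span_range_iff_exists_fun.mp (by rw [hgI]; exact hcm l)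
  choose a ha using hexp
  -- (1) a section `c_j` whose symbol is off the hyperplane `𝒯(J_D)`
  have hcg : Ideal.span (Set.range fun l => algebraMap Γ(X, U) A (c l)) = Ideal.span (Set.range g) := by
    rw [hspanA, hgI]
  obtain ⟨j, hj⟩ := exists_linForm_notMem_directrixSpace_normalCone hm hone hcg a (fun l => (ha l).symm)
  -- (2) the chart at `c_j`
  obtain ⟨gch, hgopen, hgπ, hgmem⟩ := exists_chart_of_ideal_eq_span' hπ U c hIc j
  haveI := hgopen
  -- (3) the ratios `β_k` and fractions `β_k = r_k / s_k`
  have hβex := fun k => exists_forall_sub_mul_mem_normalCone.{u, u} hd (ha j).symm hj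
    (show algebraMap Γ(X, U) A (c k) ∈ Ideal.span (Set.range g) by rw [hgI]; exact hcm k)
  choose β hβ using hβex
  have hrsex := fun k => IsLocalization.surj 𝔭.asIdeal.primeCompl (β k)
  choose rs hrs using hrsex
  -- a point of the chart over `x` lies over `𝔭`
  have hw𝔭 : ∀ (w : Spec (.of (chartRing c j))), π.base (gch w) = π.base x₁ →
      w.asIdeal.comap (CommRingCat.ofHom (chartBase c j)).hom = 𝔭.asIdeal := by
    intro w hx
    have h1 : (gch ≫ π) w = π.base x₁ := by
      rw [Scheme.Hom.comp_apply]
      exact hx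
    rw [hgπ, Scheme.Hom.comp_apply, Spec.map_apply] at h1
    have h2 : PrimeSpectrum.comap (CommRingCat.ofHom (chartBase c j)).hom w ∈ U.2.fromSpec ⁻¹' {π.base x₁} := h1
    rw [fromSpec_preimage_singleton U.2 hxU] at h2
    exact congrArg PrimeSpectrum.asIdeal ((Set.mem_singleton_iff.mp h2).trans h𝔭.symm)
  -- (K) every near point over `x` lies on the chart, at a prime over `𝔭` containing `𝔑`, with residue field `k(x)`
  have K : ∀ (x' : X') (hx : π.base x' = π.base x₁), Scheme.hsFun X' N x' = Scheme.hsFun X N (π.base x₁) →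
      ∃ w : Spec (.of (chartRing c j)), gch w = x' ∧
        𝔭.asIdeal.map (CommRingCat.ofHom (chartBase c j)).hom ⊔ Ideal.span (Set.range fun k =>
            (CommRingCat.ofHom (chartBase c j)).hom ((rs k).2 : Γ(X, U)) * chartGen c j k -
              (CommRingCat.ofHom (chartBase c j)).hom (rs k).1) ≤ w.asIdeal ∧
        IsIso (π.residueFieldMap (gch w)) := by
    intro x' hx hn'
    have hx'U : π x' ∈ (U : X.Opens) := by
      have h := hxU
      rw [← hx] at h
      exact h
    obtain ⟨E1, φ, hφgerm, hβφ, hφlift⟩ := near_point_chart_exports h51 hexc hperm hπ hdim U hxU halg hxD hgeo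
      hgI hn hE hJz hd j (ha j).symm hj β hβ hx hx'U hn'
    -- (K1) on the chart
    obtain ⟨w, rfl⟩ : x' ∈ Set.range gch := hgmem x' hx'U E1
    -- (K2) `𝔑 ≤ w` and the residue field
    have hN := rationalIdeal_le_of_chart π U (CommRingCat.ofHom (chartBase c j)) gch hgπ c j
      (fun k => chartGen c j k) (fun k => reesChartBase_apply_eq_mul_chartGen c j k)
      (reesChartBase_mem_nonZeroDivisors (c j) (Ideal.mem_span_range_self (f := c) (x := j)))
      w hx'U 𝔭.asIdeal (hw𝔭 w hx) (A := A) φ hφgerm β rs hβφ hrs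
    refine ⟨w, rfl, hN, ?_⟩
    exact isIso_residueFieldMap_of_chart π U (CommRingCat.ofHom (chartBase c j)) gch hgπ j
      (fun k => chartGen c j k) (eval₂Hom_chartGen_surjective c j) w hx'U 𝔭.asIdeal (hw𝔭 w hx) (A := A) φ hφgerm rs hN
      hφlift
  -- conclusion
  obtain ⟨w₁, hw₁, hN₁, hiso₁⟩ := K x₁ rfl hn₁
  refine ⟨fun x₂ hx₂ hn₂ => ?_, hw₁ ▸ hiso₁⟩
  obtain ⟨w₂, hw₂, hN₂, -⟩ := K x₂ hx₂ hn₂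
  rw [← hw₁, ← hw₂]
  haveI := w₁.isPrime
  haveI := w₂.isPrime
  rw [PrimeSpectrum.ext (eq_of_comap_eq_of_rationalIdeal_le (CommRingCat.ofHom (chartBase c j)).hom j
    (fun k => chartGen c j k) 𝔭.asIdeal rs (eval₂Hom_chartGen_surjective c j)
    (hw𝔭 w₁ (by rw [hw₁])) (hw𝔭 w₂ (by rw [hw₂, hx₂])) hN₁ hN₂)]

/-- **[OURS · L1 W4.2] The binder `Moving.Theorem314_nearFibre_geomDir` of the W-low rows DISCHARGED from printed facts**:
F-51′ `Hironaka1970_thmIV` and F-split `HerrmannIkedaOrbanz1988_cor_21_11` — taken as hypotheses BY NAME — imply stub-4's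
(F1♯) near-fibre binder (`…Corridor3WLadderStrataNearFibreGeomDir`). [OURS · L1 W4.2] new-combination; NOT a statement of
any source; AI-written, weaker than expert review. [cite: CossartJannsenSaito2020, Thm. 3.14; Hironaka1970NumericalCharacters, Th. IV] -/
theorem theorem314_nearFibre_geomDir_of_facts (h51 : Hironaka1970_thmIV.{u})
    (hsplit : HerrmannIkedaOrbanz1988_cor_21_11.{u}) : Moving.Theorem314_nearFibre_geomDir.{u} := by
  intro X X' _ π D hexc hperm hπ N hdim x hxD hgeo he
  exact (theorem314_nearFibre_geomDir_and_isIso_of_facts h51 hsplit π D hexc hperm hπ N hdim x hxD hgeo he).1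

/-- **The printed fact F-61 `Thm314_nearFibre_subsingleton` (CJS Thm. 3.14, near-fibre rendering, p514197) DISCHARGED
modulo F-51′ + F-split** (through stub-4's `thm314_nearFibre_subsingleton_of_geomDir`: (F1) ⇒ (F1♯)).
[OURS · L1 W4.2; AI-written] [cite: CossartJannsenSaito2020, Thm. 3.14] -/
theorem thm314_nearFibre_subsingleton_of_facts (h51 : Hironaka1970_thmIV.{u})
    (hsplit : HerrmannIkedaOrbanz1988_cor_21_11.{u}) : Thm314_nearFibre_subsingleton.{u} :=
  thm314_nearFibre_subsingleton_of_geomDir (theorem314_nearFibre_geomDir_of_facts h51 hsplit)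

/-- **Rationality of the near point** (CJS p. 103 L32 «if `e^O_x(X) ≤ 1` then `k(y) = k(x)`», general-centre form
«`ℙ(Dir_x(X)/T_x(D)) ≅ ℙ⁰_{k(x)}`»): under the hypotheses of `Moving.Theorem314_nearFibre_geomDir`, at a point `x'` over `x`
near to `x` the residue field map `k(x) → k(x')` is an isomorphism; from F-51′ + F-split BY NAME.
[OURS · L1 W4.2; AI-written] [cite: CossartJannsenSaito2020, Thm. 3.14, p. 103 L32] -/
theorem isIso_residueFieldMap_of_near_of_facts (h51 : Hironaka1970_thmIV.{u})
    (hsplit : HerrmannIkedaOrbanz1988_cor_21_11.{u})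
    {X X' : Scheme.{u}} [IsLocallyNoetherian X] {π : X' ⟶ X} {D : X.IdealSheafData}
    (hexc : Scheme.IsExcellent X) (hperm : IdealSheafData.IsPermissible D) (hπ : IsBlowup π D)
    {N : ℕ} (hdim : topologicalKrullDim X ≤ (N : WithBot ℕ∞))
    {x' : X'} (hxD : π.base x' ∈ D.support) (hgeo : GeomDirHypothesis X (π.base x'))
    (he : (Scheme.dirDim X (π.base x') : WithBot ℕ∞) ≤
      ringKrullDim (X.presheaf.stalk (π.base x') ⧸ stalkIdeal D (π.base x')) + 1)
    (hnear : Scheme.hsFun X' N x' = Scheme.hsFun X N (π.base x')) : IsIso (π.residueFieldMap x') :=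
  (theorem314_nearFibre_geomDir_and_isIso_of_facts h51 hsplit π D hexc hperm hπ N hdim (π.base x') hxD hgeo he).2
    x' rfl hnear

/-! ## By-products: the NUMERICAL binder and the POINT-centre locus binder, free of CJS Thm. 3.14 as a premise -/

/-- **The numerical binder `Moving.Theorem314_geomDir` from F-51′ + F-split ALONE** (res-type-001's T7b
`theorem314_geomDir_of_thmIV`, p518785, with its third premise `CossartJannsenSaito2020_thm_3_14` REMOVED: the
characteristic-`0` branch runs through `HironakaScheme.directrixSpace_le_prime_of_charZero`, p519965): a near point `x'`
over `x ∈ D` forces `e(J_D) ≥ 1`, and `e_x(X) = e(J_z) ≥ e(J_D) + dim 𝒪_{D,x}`. [OURS · L1 W4.2] new-combination; NOT a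
statement of any source; AI-written. [cite: Hironaka1970NumericalCharacters, Th. IV; CossartJannsenSaito2020, Thm. 3.14] -/
theorem theorem314_geomDir_of_thmIV_of_split (h51 : Hironaka1970_thmIV.{u})
    (hsplit : HerrmannIkedaOrbanz1988_cor_21_11.{u}) : Moving.Theorem314_geomDir.{u} := by
  intro X X' _ _ π D N x' x hexc hperm hπ hdim hxx' hxD hgeo hnear
  subst hxx'
  obtain ⟨n, s, g, y, hz, hgI, hn, hdimI, hE, hJz⟩ := exists_minimal_generators_data hsplit (hperm _ hxD)
  have hone : 1 ≤ directrixDim (normalConeIdeal g) :=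
    one_le_directrixDim_normalCone_of_near h51 hexc hperm hπ hdim hxD hgeo hgI hn hE hJz hnear
  have hdirDim : Scheme.dirDim X (π.base x') = directrixDim (tangentConeIdeal (Fin.append g y) hz) :=
    dirDim_eq' (X.presheaf.stalk (π.base x')) hE (Fin.append g y) hz
  have h1 := directrixDim_add_le_directrixDim_map_rename s (normalConeIdeal g)
  rw [← hJz, ← hdirDim] at h1
  have hlt : s < Scheme.dirDim X (π.base x') := by omega
  show ringKrullDim (X.presheaf.stalk (π.base x') ⧸ stalkIdeal D (π.base x')) < (Scheme.dirDim X (π.base x') : WithBot ℕ∞)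
  rw [hdimI]
  exact_mod_cast hlt

/-- **The point-centre locus binder `Moving.Thm314_point_locus_geomDir` from F-51 `Hironaka1970_thmIV_point` ALONE, in
EVERY characteristic** (stub-2's `thm314_point_locus_geomDir_of_sharp`, p515090, with its premise `Thm314_point_locus` —
CJS Thm. 3.14 as printed, used there for the characteristic-`0` branch — REMOVED): in characteristic `0` the chart argument
of res-type-001's T7 `directrix_nearPoint_of_geomDirDim_le` is run with `HironakaScheme.directrixSpace_le_prime_of_charZero`
(«`U(𝔭)` is generated by linear forms», no dimension hypothesis); in positive characteristic it is T7 with F-52/F-50b PROVED.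
[OURS · L1 W4.2] new-combination; NOT a statement of any source; AI-written.
[cite: Hironaka1970NumericalCharacters, Th. IV, (13.1) p. 168; CossartJannsenSaito2020, Thm. 3.14] -/
theorem thm314_point_locus_geomDir_of_thmIV_point (h14 : Hironaka1970_thmIV_point.{u}) :
    Moving.Thm314_point_locus_geomDir.{u} := by
  intro X X' _ π x hx N x' hexc hperm hπ hdim hxx' hgeo hnear
  rcases Nat.eq_zero_or_pos (ringChar (ResidueField (X.presheaf.stalk x))) with hc0 | hpos
  · -- characteristic `0`: T7's chart argument with `U(𝔭)` generated by linear forms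
    subst hxx'
    haveI : IsLocalHom (π.stalkMap x').hom := π.toLRSHom.prop x'
    haveI : CharP (ResidueField (X.presheaf.stalk (π.base x'))) 0 := hc0 ▸ ringChar.charP _
    haveI : CharZero (ResidueField (X.presheaf.stalk (π.base x'))) := CharP.charP_to_charZero _
    -- the chart of the exceptional divisor at `x'`
    obtain ⟨t, ht, hspan⟩ := hπ.isEffectiveCartier.exists_stalkIdeal_eq_span x'
    have hmap : (maximalIdeal (X.presheaf.stalk (π.base x'))).map (π.stalkMap x').hom = Ideal.span {t} := by
      rw [← hspan, stalkIdeal_comap_eq_map_stalkMap, stalkIdeal_vanishingIdeal_singleton hx]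
    -- embedding dimension
    rcases Nat.eq_zero_or_pos (maximalIdeal (X.presheaf.stalk (π.base x'))).spanFinrank with he0 | hepos
    · -- `emb.dim = 0`: no linear forms, the condition is vacuous
      intro L hL c hc
      have hempty : IsEmpty (Fin (maximalIdeal (X.presheaf.stalk (π.base x'))).spanFinrank) :=
        ⟨fun i => Fin.elim0 (Fin.cast he0 i)⟩
      rw [Finset.univ_eq_empty, Finset.sum_empty, map_zero]
      exact Ideal.zero_mem _
    obtain ⟨n, hn⟩ : ∃ n, (maximalIdeal (X.presheaf.stalk (π.base x'))).spanFinrank = n + 1 :=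
      ⟨_, (Nat.succ_pred_eq_of_pos hepos).symm⟩
    -- the re-indexed minimal generators
    set g : Fin (n + 1) → X.presheaf.stalk (π.base x') := minGenerators (X.presheaf.stalk (π.base x')) ∘ Fin.cast hn.symm
      with hg
    have hgspan : Ideal.span (Set.range g) = maximalIdeal (X.presheaf.stalk (π.base x')) := by
      have hsurj : Function.Surjective (Fin.cast hn.symm) := fun i => ⟨Fin.cast hn i, by simp⟩
      rw [hg, hsurj.range_comp]
      exact span_range_minGenerators _
    -- `π^♯(g_i) = u_i t`
    have hu : ∀ i, ∃ ui : X'.presheaf.stalk x', (π.stalkMap x').hom (g i) = ui * t := by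
      intro i
      have hmem : (π.stalkMap x').hom (g i) ∈ (maximalIdeal (X.presheaf.stalk (π.base x'))).map (π.stalkMap x').hom := by
        refine Ideal.mem_map_of_mem _ ?_
        rw [← hgspan]
        exact Ideal.subset_span ⟨i, rfl⟩
      rw [hmap, Ideal.mem_span_singleton'] at hmem
      obtain ⟨ui, hui⟩ := hmem
      exact ⟨ui, hui.symm⟩
    choose u hu using hu
    -- F-51 (point centre): the tangent-cone ideal is generated inside `U(𝔭_{x'})`
    have h14' := h14 X X' π (π.base x') hx N x' hexc hperm hπ hdim rfl hnear (n + 1) g hgspan t u hn ht hmap hu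
    haveI : (chartPrime (π.stalkMap x').hom u).IsPrime := isPrime_chartPrime _ u
    -- the core, characteristic `0`: `𝒯(J) ⊆ 𝔭_{x'}`
    have hcore : ∀ L ∈ directrixSpace (tangentConeIdeal g hgspan), L ∈ chartPrime (π.stalkMap x').hom u :=
      fun L hL => directrixSpace_le_prime_of_charZero h14' hL
    -- the chart dictionary, and re-indexing of the minimal generators
    have hlift : ProjDirLiftsInto (π.stalkMap x').hom g hgspan :=
      (projDirLiftsInto_iff_directrixSpace_le_chartPrime (π.stalkMap x').hom hgspan ht hmap hu).mpr hcore
    exact (projDirLiftsInto_comp_cast_iff (π.stalkMap x').hom hn.symm (span_range_minGenerators _) hgspan).mp hlift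
  · -- positive characteristic: 2.14♯ (T7) with F-52 / F-50b PROVED
    rcases hgeo with h0 | hle
    · exact absurd h0 hpos.ne'
    · exact directrix_nearPoint_of_geomDirDim_le h14 Hironaka1970_thm1_cor_holds
        (fun p _ => Summit.ResolutionOfSingularities.KangarooAtlas.Mizutani.mizutani1973_vectorGroup_of_dim_le_of_hironaka p
          (Hironaka1970_thm1_cor_holds p)) X X' π x hx N x' hexc hperm hπ hdim hxx' hpos hle hnear

/-! ## (appended 2026-08-27, same seat) The (F1) forms for the consumers holding `CharHypothesis`, and the binder shape (B4) -/

/-- **Near-fibre subsingleton AND rationality, (F1) form** (for the recognition rows (R2)/(K-ctr) that hold the printed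
characteristic hypothesis `CharHypothesis X x`, CJS (F1)): general permissible centre, any (possibly non-closed) `x ∈ D` with
`e_x(X) ≤ dim 𝒪_{D,x} + 1`; from F-51′ + F-split BY NAME ((F1) ⇒ (F1♯), `Moving.geomDirHypothesis_of_charHypothesis`).
[OURS · L1 W4.2; AI-written] [cite: CossartJannsenSaito2020, Thm. 3.14, p. 103 L32] -/
theorem nearFibre_subsingleton_and_isIso_of_facts_of_charHypothesis (h51 : Hironaka1970_thmIV.{u})
    (hsplit : HerrmannIkedaOrbanz1988_cor_21_11.{u})
    {X X' : Scheme.{u}} [IsLocallyNoetherian X] (π : X' ⟶ X) (D : X.IdealSheafData)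
    (hexc : Scheme.IsExcellent X) (hperm : IdealSheafData.IsPermissible D) (hπ : IsBlowup π D)
    (N : ℕ) (hdim : topologicalKrullDim X ≤ (N : WithBot ℕ∞))
    (x : X) (hxD : x ∈ D.support) (hchar : CharHypothesis X x)
    (he : (Scheme.dirDim X x : WithBot ℕ∞) ≤ ringKrullDim (X.presheaf.stalk x ⧸ stalkIdeal D x) + 1) :
    {x' : X' | π.base x' = x ∧ Scheme.hsFun X' N x' = Scheme.hsFun X N x}.Subsingleton ∧
      ∀ x' : X', π.base x' = x → Scheme.hsFun X' N x' = Scheme.hsFun X N x → IsIso (π.residueFieldMap x') :=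
  theorem314_nearFibre_geomDir_and_isIso_of_facts h51 hsplit π D hexc hperm hπ N hdim x hxD
    (Moving.geomDirHypothesis_of_charHypothesis hchar) he

/-- **The binder (B4) of chain w42's (R2) consumer — residual rationality of the near point over a point `y = π x'` of a
permissible centre with `𝓘_{D,y} = 𝔪_y`, (F1) and `e_y(X) = 1`** (res-L1-s42-pv-1's `CampaignW42.isIso_residueFieldMap_of_near_of_charHypothesis`,
p522235, VERBATIM binder order) — here from F-51′ `Hironaka1970_thmIV` + F-split `HerrmannIkedaOrbanz1988_cor_21_11` in place
of the printed point-centre locus fact `Thm314_point_locus` (`dim(𝒪_{X,y}/𝔪_y) = 0`, so `e_y = 1 ≤ 0 + 1`).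
[OURS · L1 W4.2; AI-written] [cite: CossartJannsenSaito2020, Thm. 3.14, Def. 6.34 (i), p. 104] -/
theorem isIso_residueFieldMap_of_near_B4_of_facts (h51 : Hironaka1970_thmIV.{u})
    (hsplit : HerrmannIkedaOrbanz1988_cor_21_11.{u}) :
    ∀ (X X' : Scheme.{u}) [IsLocallyNoetherian X] [IsLocallyNoetherian X'] (π : X' ⟶ X) (D : X.IdealSheafData),
      Scheme.IsExcellent X → IdealSheafData.IsPermissible D → IsBlowup π D →
        ∀ N : ℕ, topologicalKrullDim ↥X ≤ (N : WithBot ℕ∞) →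
          ∀ x' : X', π.base x' ∈ (D.support : Set X) →
            stalkIdeal D (π.base x') = maximalIdeal (X.presheaf.stalk (π.base x')) → CharHypothesis X (π.base x') →
              Scheme.dirDim X (π.base x') = 1 → Scheme.hsFun X' N x' = Scheme.hsFun X N (π.base x') →
                IsIso (π.residueFieldMap x') := by
  intro X X' _ _ π D hX hD hπ N hN x' hxD hDy hchar he hnear
  refine isIso_residueFieldMap_of_near_of_facts h51 hsplit hX hD hπ hN hxD
    (Moving.geomDirHypothesis_of_charHypothesis hchar) ?_ hnear
  haveI : Nontrivial (X.presheaf.stalk (π.base x') ⧸ stalkIdeal D (π.base x')) := by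
    rw [hDy]
    infer_instance
  have h0 : (0 : WithBot ℕ∞) ≤ ringKrullDim (X.presheaf.stalk (π.base x') ⧸ stalkIdeal D (π.base x')) :=
    ringKrullDim_nonneg_of_nontrivial
  rw [he, Nat.cast_one]
  calc (1 : WithBot ℕ∞) = 0 + 1 := (zero_add 1).symm
    _ ≤ ringKrullDim (X.presheaf.stalk (π.base x') ⧸ stalkIdeal D (π.base x')) + 1 := add_le_add h0 le_rfl

end Summit.ResolutionOfSingularities.ResolutionOfSingularities.Theorems.SigmaMaxModificationsCorridor3.Directrix214Sharp

end
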